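import Literature.NumberTheory.Transcendental.OddZetaAsymptotics
import HarnessLib

/-!
# Odd zeta values IV: the twisted sums are comparable (non-vanishing input)

The eliminating combination of Sprang / Fischler–Sprang–Zudilin is `∑_j w_j r_{n,j}` with
integer weights of *both signs* summing (with multiplicity) to `W ≠ 0`; it is non-zero as
soon as all the twisted sums `r_{n,j} = ∑_k u_{kD+j}` (`1 ≤ j ≤ D`) agree up to a factor
`1 + η` with `η` small in terms of the weights. FSZ 2019, Lemma 3 prove `r_{n,j}/r_{n,j'} → 1`
by Stirling's formula; here we obtain `r_{n,j} ≤ (1+η) r_{n,j'}` for `n ≥ N₀(η)` from the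
elementary estimates of `OddZetaAsymptotics.lean`:

* (C1) `abs_tsum_sub_le_of_unimodal`: for a unimodal summable sequence, two interlaced
  residue-class sums differ by at most the maximal term;
* (C2) `flat_peak`: under the drift bound `q ρ_q ≤ (q+1) ρ_{q+1}` the maximal term is at
  most `2/(t+1)` of the total mass once the mode is `≥ 2t² + t + 1`;
* (C3) `tsum_eq_sum_tsum_block`: `∑_q v_q = ∑_{j<D} ∑_k v_{kD+j}`;
* `isUnimodal_useq`: unimodality of `q ↦ u_q` for large `n` ((F2), (F3) of file III);
* `classSum_le`: the comparison `r_{n,j} ≤ (1+η) r_{n,j'}`, and `hasSum_Rfun_classSum`: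
  `∑_{m ≥ 1} R_n(m + j/D) = ∑_k u_{kD+j}` (the first `rn - 1` terms vanish).

Parameters: `D ≥ 1`, `r ≥ 2`, `σ = 32(r+1)(r+3)²`, `s = Dσ - 1`.

## References
* [FischlerSprangZudilin2019] S. Fischler, J. Sprang, W. Zudilin, Compositio Math. 155 (2019),
  §4 Lemma 3 and §6 (where `r_{n,j'}/r_{n,j} → 1` is used for non-vanishing) (arXiv:1803.08905).
* [Sprang2018OddZeta] J. Sprang, arXiv:1802.09410, Lemma 2.1 and proof of Theorem 3.1.
-/

noncomputable section

open Finset Filter Topology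

open scoped Nat

namespace Literature.NumberTheory.Transcendental.OddZeta

/-! ### (C1) Interlaced sums of a unimodal sequence -/

/-- For a unimodal summable non-negative sequence `u` with mode `qs` and a step `D ≥ 1`, the
interlaced sums `∑_k u_{kD+j+1}` and `∑_k u_{kD+j}` differ by at most `u_{qs}`. [folklore] -/
theorem abs_tsum_sub_le_of_unimodal {u : ℕ → ℝ} (hu0 : ∀ q, 0 ≤ u q) (hsum : Summable u)
    {qs : ℕ} (hinc : ∀ q, q < qs → u q ≤ u (q + 1)) (hdec : ∀ q, qs ≤ q → u (q + 1) ≤ u q)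
    {D : ℕ} (hD : 1 ≤ D) (j : ℕ) :
    |∑' k : ℕ, u (k * D + j + 1) - ∑' k : ℕ, u (k * D + j)| ≤ u qs := by
  classical
  set a : ℕ → ℕ := fun k => k * D + j with ha
  have hamono : StrictMono a := fun x y hxy => by
    simp only [ha]; have := Nat.mul_lt_mul_of_lt_of_le hxy (le_refl D) (by omega); omega
  have hainj : Function.Injective a := hamono.injective
  have hs0 : Summable (fun k => u (a k)) := hsum.comp_injective hainj
  have hs1 : Summable (fun k => u (a k + 1)) :=
    (hsum.comp_injective (add_left_injective 1)).comp_injective hainj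
  -- the splitting index
  have hex : ∃ k, qs ≤ a k := ⟨qs, by simp only [ha]; nlinarith⟩
  set k₀ := Nat.find hex with hk₀
  have hlt : ∀ k, k < k₀ → a k < qs := fun k hk => by
    have := Nat.find_min hex (hk₀ ▸ hk); exact not_le.1 this
  have hge : ∀ k, k₀ ≤ k → qs ≤ a k := fun k hk =>
    le_trans (hk₀ ▸ Nat.find_spec hex) (hamono.monotone hk)
  -- the difference as a single series
  set w : ℕ → ℝ := fun k => u (a k + 1) - u (a k) with hw
  have hws : Summable w := hs1.sub hs0
  have hdiff : ∑' k : ℕ, u (k * D + j + 1) - ∑' k : ℕ, u (k * D + j) = ∑' k, w k := by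
    rw [hw, hs1.tsum_sub hs0]
  rw [hdiff, ← Summable.sum_add_tsum_nat_add k₀ hws]
  -- head: `0 ≤ ∑_{k<k₀} w k ≤ u qs`
  have hhead0 : 0 ≤ ∑ k ∈ range k₀, w k :=
    sum_nonneg fun k hk => by
      have := hinc (a k) (hlt k (mem_range.1 hk)); rw [hw]; linarith
  have hhead1 : ∑ k ∈ range k₀, w k ≤ u qs := by
    have himg : (range k₀).image a ⊆ range qs := by
      intro q hq
      obtain ⟨k, hk, rfl⟩ := mem_image.1 hq
      exact mem_range.2 (hlt k (mem_range.1 hk))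
    calc ∑ k ∈ range k₀, w k = ∑ q ∈ (range k₀).image a, (u (q + 1) - u q) := by
          rw [sum_image fun x _ y _ h => hainj h]
      _ ≤ ∑ q ∈ range qs, (u (q + 1) - u q) :=
          sum_le_sum_of_subset_of_nonneg himg fun q hq _ => by
            have := hinc q (mem_range.1 hq); linarith
      _ = u qs - u 0 := sum_range_sub u qs
      _ ≤ u qs := by linarith [hu0 0]
  -- tail: `-u qs ≤ ∑' k, w (k + k₀) ≤ 0`
  have htail_le : ∑' k, w (k + k₀) ≤ 0 :=
    tsum_nonpos fun k => by
      have := hdec (a (k + k₀)) (hge _ (by omega)); rw [hw]; linarith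
  have htail_ge : -u qs ≤ ∑' k, w (k + k₀) := by
    have hneg : ∑' k, w (k + k₀) = -∑' k, (u (a (k + k₀)) - u (a (k + k₀) + 1)) := by
      rw [← tsum_neg]; exact tsum_congr fun k => by rw [hw]; ring
    rw [hneg, neg_le_neg_iff]
    refine Real.tsum_le_of_sum_range_le (fun k => ?_) fun K => ?_
    · have := hdec (a (k + k₀)) (hge _ (by omega)); linarith
    · -- compare with the telescoping sum over `[qs, a (K + k₀))`
      set M := a (K + k₀)
      have himg : (range K).image (fun k => a (k + k₀)) ⊆ Ico qs M := by
        intro q hq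
        obtain ⟨k, hk, rfl⟩ := mem_image.1 hq
        rw [mem_Ico]
        exact ⟨hge _ (by omega), hamono (by have := mem_range.1 hk; omega)⟩
      have hinj' : Set.InjOn (fun k => a (k + k₀)) (range K) :=
        fun x _ y _ h => by have := hainj h; omega
      calc ∑ k ∈ range K, (u (a (k + k₀)) - u (a (k + k₀) + 1))
          = ∑ q ∈ (range K).image (fun k => a (k + k₀)), (u q - u (q + 1)) := by
            rw [sum_image hinj']
        _ ≤ ∑ q ∈ Ico qs M, (u q - u (q + 1)) :=
            sum_le_sum_of_subset_of_nonneg himg fun q hq _ => by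
              have := hdec q (mem_Ico.1 hq).1; linarith
        _ = u qs - u M := by
            have hqsM : qs ≤ M := hge _ (by omega)
            rw [sum_Ico_eq_sum_range]
            have := sum_range_sub' (fun i => u (qs + i)) (M - qs)
            simp only [add_zero] at this
            rw [show qs + (M - qs) = M by omega] at this
            rw [← this]
            refine sum_congr rfl fun i _ => ?_
            ring_nf
        _ ≤ u qs := by linarith [hu0 M]
  rw [abs_le]
  constructor <;> linarith

/-- Iterating (C1): interlaced sums with offsets `j` and `j + t` differ by at most `t · u_{qs}`.
[folklore] -/
theorem abs_tsum_sub_le_of_unimodal' {u : ℕ → ℝ} (hu0 : ∀ q, 0 ≤ u q) (hsum : Summable u)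
    {qs : ℕ} (hinc : ∀ q, q < qs → u q ≤ u (q + 1)) (hdec : ∀ q, qs ≤ q → u (q + 1) ≤ u q)
    {D : ℕ} (hD : 1 ≤ D) (j t : ℕ) :
    |∑' k : ℕ, u (k * D + (j + t)) - ∑' k : ℕ, u (k * D + j)| ≤ t * u qs := by
  induction t with
  | zero => simp
  | succ t ih =>
    have h1 := abs_tsum_sub_le_of_unimodal hu0 hsum hinc hdec hD (j + t)
    have e : ∀ k, k * D + (j + (t + 1)) = k * D + (j + t) + 1 := fun k => by ring
    simp_rw [e]
    calc |∑' k : ℕ, u (k * D + (j + t) + 1) - ∑' k : ℕ, u (k * D + j)|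
        = |(∑' k : ℕ, u (k * D + (j + t) + 1) - ∑' k : ℕ, u (k * D + (j + t))) +
            (∑' k : ℕ, u (k * D + (j + t)) - ∑' k : ℕ, u (k * D + j))| := by congr 1; ring
      _ ≤ |∑' k : ℕ, u (k * D + (j + t) + 1) - ∑' k : ℕ, u (k * D + (j + t))| +
            |∑' k : ℕ, u (k * D + (j + t)) - ∑' k : ℕ, u (k * D + j)| := abs_add_le _ _
      _ ≤ u qs + t * u qs := add_le_add h1 ih
      _ = (t + 1 : ℕ) * u qs := by push_cast; ring

/-! ### (C2) The flat peak -/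

/-- `(1 + y)^t ≤ 1/(1 - t y)` for `0 ≤ y`, `t y < 1`. [folklore] -/
theorem one_add_pow_le_inv {y : ℝ} (hy : 0 ≤ y) {t : ℕ} (hty : (t : ℝ) * y < 1) :
    (1 + y) ^ t ≤ 1 / (1 - t * y) := by
  rcases Nat.eq_zero_or_pos t with h | h
  · subst h; simp
  have ht1 : (1 : ℝ) ≤ t := by exact_mod_cast h
  have hy1 : y < 1 := by nlinarith
  have hB : 1 - t * y ≤ (1 - y) ^ t := by
    have := one_add_mul_le_pow (a := -y) (by linarith) t
    calc 1 - t * y = 1 + t * (-y) := by ring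
      _ ≤ (1 + -y) ^ t := this
      _ = (1 - y) ^ t := by ring
  have h1 : (1 + y) ^ t * (1 - y) ^ t ≤ 1 := by
    rw [← mul_pow]; exact pow_le_one₀ (by nlinarith) (by nlinarith)
  have hpos : 0 < (1 - y) ^ t := pow_pos (by linarith) t
  calc (1 + y) ^ t ≤ 1 / (1 - y) ^ t := by rw [le_div_iff₀ hpos]; exact h1
    _ ≤ 1 / (1 - t * y) := one_div_le_one_div_of_le (by linarith) hB

/-- **(C2) Flat peak.** Let `u_q > 0` (`q ≥ 1`) with ratios `u_{q+1} = ρ_q u_q` satisfying the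
drift bound `q ρ_q ≤ (q+1) ρ_{q+1}`. If `u_{qs+1} ≤ u_{qs}` and `qs ≥ 2t² + t + 1`, then the
`t + 1` terms `u_{qs-t}, …, u_{qs}` are all `≥ u_{qs}/2`; in particular
`(t+1) u_{qs} ≤ 2 ∑_{qs-t ≤ q ≤ qs} u_q`. [folklore] -/
theorem flat_peak {u ρ : ℕ → ℝ} (hpos : ∀ q, 1 ≤ q → 0 < u q)
    (hρ : ∀ q, 1 ≤ q → u (q + 1) = ρ q * u q)
    (hdrift : ∀ q : ℕ, 1 ≤ q → (q : ℝ) * ρ q ≤ ((q : ℝ) + 1) * ρ (q + 1)) {qs t : ℕ}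
    (hmode : u (qs + 1) ≤ u qs) (hqs : 2 * t ^ 2 + t + 1 ≤ qs) :
    ((t : ℝ) + 1) * u qs ≤ 2 * ∑ q ∈ Icc (qs - t) qs, u q := by
  have hqs1 : 1 ≤ qs := by nlinarith
  have hρpos : ∀ q, 1 ≤ q → 0 < ρ q := fun q hq => by
    have h1 := hρ q hq
    have h2 := hpos q hq
    have h3 := hpos (q + 1) (by omega)
    rw [h1] at h3
    exact pos_of_mul_pos_left h3 h2.le
  have hρqs : ρ qs ≤ 1 := by
    have h1 := hρ qs hqs1
    have h2 := hpos qs hqs1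
    rw [h1] at hmode
    nlinarith
  -- the chain `l ρ_l ≤ qs ρ_qs ≤ qs`
  have hchain : ∀ d l, 1 ≤ l → l + d = qs → (l : ℝ) * ρ l ≤ (qs : ℝ) * ρ qs := by
    intro d
    induction d with
    | zero => intro l _ hl; rw [add_zero] at hl; subst hl; exact le_rfl
    | succ d ih =>
      intro l hl1 hl
      have h1 := hdrift l hl1
      have h2 := ih (l + 1) (by omega) (by omega)
      push_cast at h2
      linarith
  have hρle : ∀ l, 1 ≤ l → l ≤ qs → ρ l ≤ (qs : ℝ) / l := by
    intro l hl1 hl2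
    have h := hchain (qs - l) l hl1 (by omega)
    have hl' : (0 : ℝ) < l := by exact_mod_cast hl1
    rw [le_div_iff₀ hl']
    have hqs' : (0 : ℝ) ≤ qs := Nat.cast_nonneg _
    nlinarith [mul_le_of_le_one_right hqs' hρqs]
  -- the product formula
  have hprod : ∀ q, 1 ≤ q → ∀ d, u (q + d) = u q * ∏ i ∈ range d, ρ (q + i) := by
    intro q hq d
    induction d with
    | zero => simp
    | succ d ih => rw [prod_range_succ, ← add_assoc, hρ (q + d) (by omega), ih]; ring
  -- the base bound `(qs/(qs-t))^t ≤ 2`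
  have ht2 : t ≤ qs := by nlinarith
  have hqt : (0 : ℝ) < (qs : ℝ) - t := by
    have : ((2 * t ^ 2 + t + 1 : ℕ) : ℝ) ≤ qs := by exact_mod_cast hqs
    push_cast at this; nlinarith
  have hbase : ((qs : ℝ) / ((qs : ℝ) - t)) ^ t ≤ 2 := by
    set y : ℝ := (t : ℝ) / ((qs : ℝ) - t) with hydef
    have hy : 0 ≤ y := by positivity
    have e : (qs : ℝ) / ((qs : ℝ) - t) = 1 + y := by rw [hydef]; field_simp; ring
    have hty : (t : ℝ) * y ≤ 1 / 2 := by
      rw [hydef, ← mul_div_assoc, div_le_iff₀ hqt]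
      have : ((2 * t ^ 2 + t + 1 : ℕ) : ℝ) ≤ qs := by exact_mod_cast hqs
      push_cast at this; nlinarith
    rw [e]
    calc (1 + y) ^ t ≤ 1 / (1 - t * y) := one_add_pow_le_inv hy (by linarith)
      _ ≤ 2 := by rw [div_le_iff₀ (by linarith)]; linarith
  -- termwise: `u qs ≤ 2 u q` for `qs - t ≤ q ≤ qs`
  have hterm : ∀ q ∈ Icc (qs - t) qs, u qs ≤ 2 * u q := by
    intro q hq
    obtain ⟨hq1, hq2⟩ := mem_Icc.1 hq
    have hqpos : 1 ≤ q := by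
      have : 2 * t ^ 2 + 1 ≤ qs - t := by omega
      omega
    have hq' : (0 : ℝ) < q := by exact_mod_cast hqpos
    set d := qs - q with hd
    have hdt : d ≤ t := by omega
    have hform := hprod q hqpos d
    rw [show q + d = qs by omega] at hform
    -- bound the product
    have hprodle : ∏ i ∈ range d, ρ (q + i) ≤ ((qs : ℝ) / q) ^ d := by
      calc ∏ i ∈ range d, ρ (q + i) ≤ ∏ _i ∈ range d, ((qs : ℝ) / q) := by
            refine prod_le_prod (fun i _ => (hρpos (q + i) (by omega)).le) fun i hi => ?_
            have hi' := mem_range.1 hi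
            refine (hρle (q + i) (by omega) (by omega)).trans ?_
            push_cast
            exact div_le_div_of_nonneg_left (Nat.cast_nonneg _) hq' (by linarith [(Nat.cast_nonneg (α := ℝ) i)])
        _ = ((qs : ℝ) / q) ^ d := by rw [prod_const, card_range]
    have hbase1 : (1 : ℝ) ≤ (qs : ℝ) / q := by
      rw [le_div_iff₀ hq', one_mul]; exact_mod_cast hq2
    have hpow : ((qs : ℝ) / q) ^ d ≤ 2 :=
      calc ((qs : ℝ) / q) ^ d ≤ ((qs : ℝ) / q) ^ t := pow_le_pow_right₀ hbase1 hdt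
        _ ≤ ((qs : ℝ) / ((qs : ℝ) - t)) ^ t := by
            refine pow_le_pow_left₀ (by positivity) ?_ t
            refine div_le_div_of_nonneg_left (Nat.cast_nonneg _) hqt ?_
            have h' : ((qs - t : ℕ) : ℝ) ≤ q := by exact_mod_cast hq1
            rw [Nat.cast_sub ht2] at h'
            exact h'
        _ ≤ 2 := hbase
    have huq := hpos q hqpos
    rw [hform]
    nlinarith [mul_le_mul_of_nonneg_left hpow huq.le, mul_le_mul_of_nonneg_left hprodle huq.le]
  calc ((t : ℝ) + 1) * u qs = ∑ _q ∈ Icc (qs - t) qs, u qs := by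
        rw [sum_const, Nat.card_Icc, nsmul_eq_mul]
        congr 1
        rw [show qs + 1 - (qs - t) = t + 1 by omega]
        push_cast; ring
    _ ≤ ∑ q ∈ Icc (qs - t) qs, 2 * u q := sum_le_sum hterm
    _ = 2 * ∑ q ∈ Icc (qs - t) qs, u q := by rw [mul_sum]

/-! ### (C3) Block sums -/

/-- Nested sums over blocks: `∑_{b<B} ∑_{j<n} f(bn+j) = ∑_{l<Bn} f(l)`. [folklore] -/
theorem sum_range_mul_nest (f : ℕ → ℝ) (B n : ℕ) :
    ∑ b ∈ range B, ∑ j ∈ range n, f (b * n + j) = ∑ l ∈ range (B * n), f l := by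
  induction B with
  | zero => simp
  | succ B ih =>
    rw [sum_range_succ, ih, Nat.succ_mul, sum_range_add]

/-- **(C3)**: `∑_q v_q = ∑_{j<D} ∑_k v_{kD+j}` for a summable `v` and `D ≥ 1`. [folklore] -/
theorem tsum_eq_sum_tsum_block {v : ℕ → ℝ} (hv : Summable v) {D : ℕ} (hD : 1 ≤ D) :
    ∑' q, v q = ∑ j ∈ range D, ∑' k, v (k * D + j) := by
  have hinj : ∀ j, Function.Injective (fun k : ℕ => k * D + j) := fun j x y h => by
    have h' : x * D + j = y * D + j := h
    have h2 : x * D = y * D := by omega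
    exact Nat.eq_of_mul_eq_mul_right (by omega) h2
  have h1 : Tendsto (fun K : ℕ => ∑ q ∈ range (K * D), v q) atTop (𝓝 (∑' q, v q)) :=
    hv.hasSum.tendsto_sum_nat.comp (tendsto_atTop_mono (fun K => Nat.le_mul_of_pos_right K (by omega)) tendsto_id)
  have h2 : ∀ K : ℕ, ∑ q ∈ range (K * D), v q = ∑ j ∈ range D, ∑ k ∈ range K, v (k * D + j) := by
    intro K
    rw [← sum_range_mul_nest v K D, sum_comm]
  have h3 : Tendsto (fun K : ℕ => ∑ j ∈ range D, ∑ k ∈ range K, v (k * D + j)) atTop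
      (𝓝 (∑ j ∈ range D, ∑' k, v (k * D + j))) :=
    tendsto_finsetSum _ fun j _ => (hv.comp_injective (hinj j)).hasSum.tendsto_sum_nat
  simp_rw [h2] at h1
  exact tendsto_nhds_unique h1 h3

/-! ### Parameters and thresholds -/

/-- `θ₁ = (r+2)/(r+3)`. [folklore] -/
def theta1 (r : ℕ) : ℝ := ((r : ℝ) + 2) / ((r : ℝ) + 3)

/-- `Q₁ = D(rn-1)/(4σ)`: log-concavity holds up to `Q₁`. [folklore] -/
def Qone (r D σ n : ℕ) : ℝ := (D : ℝ) * ((r : ℝ) * n - 1) / (4 * σ)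

/-- `Q₂ = 2(L+1)θ₁^σ`: the samples decrease from `Q₂` on. [folklore] -/
def Qtwo (r D σ n : ℕ) : ℝ := 2 * ((Lnum r D n + 1 : ℕ) : ℝ) * theta1 r ^ σ

/-- `0 < θ₁ < 1`. [folklore] -/
theorem theta1_pos (r : ℕ) : 0 < theta1 r := by unfold theta1; positivity

/-- `θ₁ ≤ 1`. [folklore] -/
theorem theta1_le_one (r : ℕ) : theta1 r ≤ 1 := by
  unfold theta1; rw [div_le_one (by positivity)]; linarith

/-- `θ₁^{r+3} ≤ 1/2` (from `(1 - 1/k)^k ≤ e^{-1} ≤ 1/2`). [folklore] -/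
theorem theta1_pow_le_half (r : ℕ) : theta1 r ^ (r + 3) ≤ 1 / 2 := by
  have h1 : theta1 r = 1 - 1 / ((r + 3 : ℕ) : ℝ) := by
    unfold theta1; push_cast; field_simp; ring
  rw [h1]
  have h2 := Real.one_sub_div_pow_le_exp_neg (n := r + 3) (t := 1) (by push_cast; linarith)
  refine h2.trans ?_
  have h3 : (2 : ℝ) ≤ Real.exp 1 := by
    have := Real.add_one_le_exp (1 : ℝ); linarith
  rw [Real.exp_neg, inv_eq_one_div]
  exact one_div_le_one_div_of_le (by norm_num) h3

/-- `λ² ≤ 2^λ` for `λ ≥ 4`. [folklore] -/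
theorem sq_le_two_pow {k : ℕ} (hk : 4 ≤ k) : k ^ 2 ≤ 2 ^ k := by
  induction k with
  | zero => omega
  | succ k ih =>
    rcases Nat.lt_or_ge k 4 with h | h
    · interval_cases k <;> omega
    · have := ih h
      have h2 : 2 * k + 1 ≤ k ^ 2 := by nlinarith
      calc (k + 1) ^ 2 = k ^ 2 + (2 * k + 1) := by ring
        _ ≤ k ^ 2 + k ^ 2 := by omega
        _ ≤ 2 ^ k + 2 ^ k := by omega
        _ = 2 ^ (k + 1) := by ring

/-! ### (L1)–(L4): the ratio estimates in the chosen parameters -/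

section Params

variable {r D s σ n : ℕ}

/-- **(L1)** For `1 ≤ q ≤ Q₁` (and `rn ≥ 2`, `σ < D(rn-1)`, `Q₁ ≥ 1`): `ρ_{q+1} ≤ ρ_q`.
[folklore] -/
theorem rho_succ_le_of_le_Qone (hD : 0 < D) (hS : s + 1 = D * σ) (hrn : 2 ≤ r * n)
    (hσn : (σ : ℝ) < D * ((r : ℝ) * n - 1)) (hQ1 : 1 ≤ Qone r D σ n) {q : ℕ} (hq : 1 ≤ q)
    (hqQ : (q : ℝ) ≤ Qone r D σ n) : rho r D s n (q + 1) ≤ rho r D s n q := by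
  have hD' : (0 : ℝ) < D := by exact_mod_cast hD
  have hσ0 : (0 : ℝ) ≤ σ := Nat.cast_nonneg σ
  have hrn' : (2 : ℝ) ≤ (r : ℝ) * n := by exact_mod_cast hrn
  have hq' : (1 : ℝ) ≤ q := by exact_mod_cast hq
  set B₀ : ℝ := (D : ℝ) * ((r : ℝ) * n - 1) with hB₀
  have hB₀pos : 0 < B₀ := by rw [hB₀]; nlinarith
  have hσpos : (0 : ℝ) < σ := by
    -- `Q₁ ≥ 1` forces `σ > 0`
    by_contra h
    have hσ0' : (σ : ℝ) = 0 := le_antisymm (not_lt.1 h) hσ0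
    unfold Qone at hQ1; rw [hσ0'] at hQ1; simp at hQ1; linarith
  -- `Y₀ - D = B₀ + q`
  have hY0 : (Ynat r D n q 0 : ℝ) - D = B₀ + q := by unfold Ynat; push_cast; rw [hB₀]; ring
  have hYD : D < Ynat r D n q 0 := by
    have : (D : ℝ) < (Ynat r D n q 0 : ℝ) := by linarith
    exact_mod_cast this
  -- `τ ≤ τ₀ = σ / B₀`
  set τ : ℝ := ((s + 1 : ℕ) : ℝ) / (D * ((Ynat r D n q 0 : ℝ) - D)) with hτ
  have hS' : ((s + 1 : ℕ) : ℝ) = D * σ := by exact_mod_cast hS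
  have hτle : τ ≤ σ / B₀ := by
    rw [hτ, hS', hY0]
    rw [div_le_div_iff₀ (by positivity) hB₀pos]
    nlinarith [mul_nonneg hD'.le hσ0, mul_nonneg (mul_nonneg hD'.le hσ0) (by linarith : (0:ℝ) ≤ q)]
  have hτ0lt : σ / B₀ < 1 := by rw [div_lt_one hB₀pos]; exact hσn
  have hτlt : τ < 1 := lt_of_le_of_lt hτle hτ0lt
  -- the key inequality `τ (q + A)(q+1) ≤ A`
  set A : ℝ := ((Lnum r D n + 1 : ℕ) : ℝ) with hA
  have hQA : Qone r D σ n ≤ A := by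
    unfold Qone; rw [hA, Lnum]; push_cast
    rw [div_le_iff₀ (by positivity)]
    have hσ1 : (1 : ℝ) ≤ σ := by
      have : Qone r D σ n ≤ Qone r D σ n := le_rfl
      by_contra h; rw [not_le] at h
      -- σ is a natural number with 0 < σ, hence ≥ 1
      have : (1 : ℝ) ≤ σ := by exact_mod_cast Nat.one_le_iff_ne_zero.2 (by
        rintro rfl; simp at hσpos)
      linarith
    nlinarith [mul_nonneg hD'.le (by linarith : (0:ℝ) ≤ (r:ℝ) * n)]
  have hkey : τ * ((q : ℝ) + A) * (q + 1) ≤ A := by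
    have hτ0 : 0 ≤ τ := by rw [hτ]; apply div_nonneg (by positivity); nlinarith
    have hA0 : 0 ≤ A := by positivity
    have h1 : τ * ((q : ℝ) + A) * (q + 1) ≤ (σ / B₀) * (2 * A) * (Qone r D σ n + 1) := by
      have e1 : (q : ℝ) + A ≤ 2 * A := by linarith
      have e2 : (q : ℝ) + 1 ≤ Qone r D σ n + 1 := by linarith
      calc τ * ((q : ℝ) + A) * (q + 1) ≤ (σ / B₀) * ((q : ℝ) + A) * (q + 1) := by
            gcongr
        _ ≤ (σ / B₀) * (2 * A) * (Qone r D σ n + 1) := by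
            have : 0 ≤ σ / B₀ := by positivity
            gcongr
    refine h1.trans ?_
    -- `2 (σ/B₀) (Q₁ + 1) ≤ 1` since `Q₁ = B₀/(4σ) ≥ 1`
    have hQdef : Qone r D σ n = B₀ / (4 * σ) := by unfold Qone; rw [hB₀]
    have h2 : (σ / B₀) * (2 * A) * (Qone r D σ n + 1) ≤ (σ / B₀) * (2 * A) * (2 * Qone r D σ n) := by
      have : 0 ≤ (σ / B₀) * (2 * A) := by positivity
      exact mul_le_mul_of_nonneg_left (by linarith) this
    refine h2.trans (le_of_eq ?_)
    rw [hQdef]; field_simp; ring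
  refine rho_succ_le hD hq hYD hτlt ?_
  have h := hkey
  rw [hτ, hA] at h
  push_cast at h ⊢
  exact h

/-- Chain of (L1): `ρ` is non-increasing on `[1, Q₁ + 1]`. [folklore] -/
theorem rho_antitone (hD : 0 < D) (hS : s + 1 = D * σ) (hrn : 2 ≤ r * n)
    (hσn : (σ : ℝ) < D * ((r : ℝ) * n - 1)) (hQ1 : 1 ≤ Qone r D σ n) {q q' : ℕ} (hq : 1 ≤ q)
    (hqq : q ≤ q') (hq' : (q' : ℝ) ≤ Qone r D σ n + 1) : rho r D s n q' ≤ rho r D s n q := by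
  obtain ⟨d, rfl⟩ := Nat.exists_eq_add_of_le hqq
  induction d with
  | zero => exact le_rfl
  | succ d ih =>
    have h1 : ((q + d : ℕ) : ℝ) ≤ Qone r D σ n := by push_cast at hq' ⊢; linarith
    have h2 := rho_succ_le_of_le_Qone hD hS hrn hσn hQ1 (q := q + d) (by omega) h1
    have h3 := ih (by omega) (by push_cast at hq' ⊢; linarith)
    rw [← add_assoc]
    exact h2.trans h3

/-- **(L2)** For `q ≥ Q₂` (with `θ₁^σ ≤ 1/2`, `(r+1)(r+5) ≤ σ`, `n ≥ 1`): `ρ_q ≤ 1`. [folklore] -/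
theorem rho_le_one_of_Qtwo_le (hD : 0 < D) (hS : s + 1 = D * σ) (hn : 1 ≤ n)
    (hθ : theta1 r ^ σ ≤ 1 / 2) (hσr : (r + 1) * (r + 5) ≤ σ) {q : ℕ} (hq : 1 ≤ q)
    (hqQ : Qtwo r D σ n ≤ q) : rho r D s n q ≤ 1 := by
  have hD' : (1 : ℝ) ≤ D := by exact_mod_cast hD
  have hn' : (1 : ℝ) ≤ n := by exact_mod_cast hn
  have hq' : (1 : ℝ) ≤ q := by exact_mod_cast hq
  have hr0 : (0 : ℝ) ≤ r := Nat.cast_nonneg r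
  set A : ℝ := ((Lnum r D n + 1 : ℕ) : ℝ) with hA
  have hApos : 0 < A := by rw [hA]; positivity
  have hθ0 : 0 < theta1 r ^ σ := pow_pos (theta1_pos r) σ
  rcases le_or_gt (q : ℝ) (2 * D * n) with hmid | hfar
  · -- middle range
    refine rho_le_one_mid (σ := σ) hS hq (θ := theta1 r) ?_ ?_
    · -- `W/(W+c) ≤ θ₁` iff `W ≤ (r+2) c`
      unfold theta1 Ynat
      push_cast
      rw [div_le_div_iff₀ (by positivity) (by positivity)]
      nlinarith [mul_nonneg (by linarith : (0:ℝ) ≤ (r:ℝ) + 2) (by linarith : (0:ℝ) ≤ (D:ℝ) - 1),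
        mul_nonneg hr0 (by linarith : (0:ℝ) ≤ (D:ℝ)), hD', hn']
    · -- `(1 + A/q) θ^σ ≤ θ^σ + A θ^σ / Q₂ = θ^σ + 1/2 ≤ 1`
      have hQ2 : Qtwo r D σ n = 2 * A * theta1 r ^ σ := by unfold Qtwo; rw [hA]
      have hq0 : (0 : ℝ) < q := by linarith
      have h1 : A / q * theta1 r ^ σ ≤ 1 / 2 := by
        rw [div_mul_eq_mul_div, div_le_iff₀ hq0]
        rw [hQ2] at hqQ; linarith
      rw [← hA]
      nlinarith
  · -- far range
    refine rho_le_one_far (σ := σ) hD hS hq ?_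
    rw [← hA]
    -- `A W₀ ≤ (2r+2)(r+3) D²n²` and `q (σ D (n+1) - A) ≥ 2Dn (σ - 2r - 2) D n`
    have hAle : A ≤ (2 * r + 2) * D * n := by
      rw [hA, Lnum]; push_cast; nlinarith
    have hW0 : ((D * r * n + D * n + D + 1 : ℕ) : ℝ) ≤ (r + 3) * D * n := by
      push_cast; nlinarith [mul_nonneg (by linarith : (0:ℝ) ≤ (D:ℝ)) (by linarith : (0:ℝ) ≤ (n:ℝ) - 1)]
    have hσr' : (((r + 1) * (r + 5) : ℕ) : ℝ) ≤ σ := by exact_mod_cast hσr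
    push_cast at hσr'
    have hgap : (2 * r + 2) * (D : ℝ) * n ≤ (σ : ℝ) * (D * (n + 1)) - A := by
      have : (σ : ℝ) * (D * (n + 1)) ≥ σ * (D * n) := by nlinarith [Nat.cast_nonneg (α := ℝ) σ]
      nlinarith [mul_nonneg (by nlinarith : (0:ℝ) ≤ (σ:ℝ) - 4 * r - 4) (by positivity : (0:ℝ) ≤ (D:ℝ) * n)]
    calc A * ((D * r * n + D * n + D + 1 : ℕ) : ℝ) ≤ ((2 * r + 2) * D * n) * ((r + 3) * D * n) :=
          mul_le_mul hAle hW0 (by positivity) (by positivity)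
      _ ≤ (2 * D * n) * ((σ : ℝ) * (D * (n + 1)) - A) := by
          have h1 : ((2 * r + 2) * (D : ℝ) * n) * ((r + 3) * D * n) ≤ (2 * D * n) * ((σ - 2 * r - 2) * D * n) := by
            have : (2 * (r : ℝ) + 2) * (r + 3) ≤ 2 * (σ - 2 * r - 2) := by nlinarith
            nlinarith [mul_nonneg (mul_nonneg (by positivity : (0:ℝ) ≤ (D:ℝ) * n) (by positivity : (0:ℝ) ≤ (D:ℝ) * n)) (by nlinarith : (0:ℝ) ≤ 2 * ((σ:ℝ) - 2 * r - 2) - (2 * r + 2) * (r + 3))]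
          refine h1.trans ?_
          refine mul_le_mul_of_nonneg_left ?_ (by positivity)
          nlinarith [Nat.cast_nonneg (α := ℝ) σ, hD', hn']
      _ ≤ (q : ℝ) * ((σ : ℝ) * (D * (n + 1)) - A) :=
          mul_le_mul_of_nonneg_right hfar.le (by nlinarith [hgap, hD', hn'])

/-- **(L3)** `Q₂ ≤ Q₁` when `σ = 32(r+1)(r+3)²`, `r ≥ 1`, `rn ≥ 2`. [folklore] -/
theorem Qtwo_le_Qone (hD : 0 < D) (hr : 1 ≤ r) (hσ : σ = 32 * (r + 1) * (r + 3) ^ 2)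
    (hrn : 2 ≤ r * n) : Qtwo r D σ n ≤ Qone r D σ n := by
  have hD' : (1 : ℝ) ≤ D := by exact_mod_cast hD
  have hr' : (1 : ℝ) ≤ r := by exact_mod_cast hr
  have hrn' : (2 : ℝ) ≤ (r : ℝ) * n := by exact_mod_cast hrn
  set lam := 32 * (r + 1) * (r + 3) with hlam
  have hσ' : σ = (r + 3) * lam := by rw [hσ, hlam]; ring
  have hlam4 : 4 ≤ lam := by rw [hlam]; nlinarith
  -- `θ^σ ≤ (1/2)^λ ≤ 1/λ²`
  have hθ : theta1 r ^ σ ≤ (1 / 2) ^ lam := by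
    rw [hσ', pow_mul]
    exact pow_le_pow_left₀ (pow_nonneg (theta1_pos r).le _) (theta1_pow_le_half r) lam
  have hpow : ((lam : ℕ) : ℝ) ^ 2 * (1 / 2 : ℝ) ^ lam ≤ 1 := by
    have h1 : ((lam ^ 2 : ℕ) : ℝ) ≤ ((2 ^ lam : ℕ) : ℝ) := by exact_mod_cast sq_le_two_pow hlam4
    push_cast at h1
    rw [div_pow, one_pow, ← div_eq_mul_one_div, div_le_one (by positivity)]
    exact h1
  -- compare
  unfold Qtwo Qone
  rw [Lnum]
  have hσR : (σ : ℝ) = (r + 3) * lam := by rw [hσ']; push_cast; ring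
  have hlamR : (lam : ℝ) = 32 * (r + 1) * (r + 3) := by rw [hlam]; push_cast; ring
  rw [le_div_iff₀ (by rw [hσR]; positivity)]
  have hn1 : 1 ≤ n := Nat.pos_of_ne_zero (by rintro rfl; simp at hrn)
  have hn' : (1 : ℝ) ≤ n := by exact_mod_cast hn1
  have hDn : (1 : ℝ) ≤ (D : ℝ) * n := one_le_mul_of_one_le_of_one_le hD' hn'
  have hA : (((2 * r + 1) * D * n + 1 : ℕ) : ℝ) ≤ (2 * r + 2) * D * n := by
    push_cast; nlinarith
  -- `2 A θ^σ · 4σ ≤ 8 (2r+2) D n (r+3) λ (1/2)^λ ≤ D r n / 2 ≤ D (rn - 1)` using λ²(1/2)^λ ≤ 1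
  have hθ' : 0 ≤ theta1 r ^ σ := pow_nonneg (theta1_pos r).le _
  calc 2 * (((2 * r + 1) * D * n + 1 : ℕ) : ℝ) * theta1 r ^ σ * (4 * σ)
      ≤ 2 * ((2 * r + 2) * D * n) * (1 / 2 : ℝ) ^ lam * (4 * ((r + 3) * lam)) := by
        rw [hσR]; gcongr
    _ = (D : ℝ) * n * (16 * (r + 1) * (r + 3)) * ((lam : ℝ) * (1 / 2 : ℝ) ^ lam) := by ring
    _ = (D : ℝ) * n * (1 / 2) * (((lam : ℕ) : ℝ) ^ 2 * (1 / 2 : ℝ) ^ lam) := by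
        rw [hlamR]; ring
    _ ≤ (D : ℝ) * n * (1 / 2) * 1 := by gcongr
    _ ≤ (D : ℝ) * ((r : ℝ) * n - 1) := by
        have hnr : (n : ℝ) ≤ (r : ℝ) * n := le_mul_of_one_le_left (by positivity) hr'
        nlinarith [mul_nonneg (by linarith : (0:ℝ) ≤ (D:ℝ)) (by linarith : (0:ℝ) ≤ (r:ℝ) * n / 2 - 1),
          mul_le_mul_of_nonneg_left hnr (by linarith : (0:ℝ) ≤ (D:ℝ))]

/-- **(L4)** For `1 ≤ q ≤ q₀` and `2 q₀ ≤ (2r+1) D n · ((r-1)/(r+1))^σ`: `2 ≤ ρ_q`. [folklore] -/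
theorem two_le_rho (hD : 0 < D) (hS : s + 1 = D * σ) (hr : 1 ≤ r) (hn : 1 ≤ n) {q q₀ : ℕ}
    (hq : 1 ≤ q) (hq0 : q ≤ q₀)
    (h : 2 * (q₀ : ℝ) ≤ (2 * r + 1) * D * n * (((r : ℝ) - 1) / ((r : ℝ) + 1)) ^ σ) :
    2 ≤ rho r D s n q := by
  have hb := rho_ge (σ := σ) hD hS hr hn hq hq0
  refine le_trans ?_ hb
  have hq0pos : (0 : ℝ) < q₀ := by
    have : (1 : ℝ) ≤ q := by exact_mod_cast hq
    have : (q : ℝ) ≤ q₀ := by exact_mod_cast hq0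
    linarith
  rw [div_mul_eq_mul_div, le_div_iff₀ hq0pos]
  have hA : (2 * (r : ℝ) + 1) * D * n ≤ ((Lnum r D n + 1 : ℕ) : ℝ) := by
    rw [Lnum]; push_cast; linarith
  have hπ : 0 ≤ (((r : ℝ) - 1) / ((r : ℝ) + 1)) ^ σ := by
    apply pow_nonneg; apply div_nonneg <;> [linarith [(show (1:ℝ) ≤ r by exact_mod_cast hr)]; positivity]
  nlinarith [mul_le_mul_of_nonneg_right hA hπ]

end Params

/-! ### The mode and unimodality -/

/-- The residue-class sums `r_{n,j} = ∑_k u_{kD+j}`. [cite: FischlerSprangZudilin2019, §4 (r_{n,j} = ∑_k c_{k,j})] -/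
def classSum (r D s n j : ℕ) : ℝ := ∑' k : ℕ, useq r D s n (k * D + j)

section Assembly

variable {r D s σ n : ℕ}

/-- `θ₁^σ ≤ 1/2` for `σ = 32(r+1)(r+3)²`. [folklore] -/
theorem theta1_pow_sigma_le (hσ : σ = 32 * (r + 1) * (r + 3) ^ 2) : theta1 r ^ σ ≤ 1 / 2 := by
  have e : σ = (r + 3) * (32 * (r + 1) * (r + 3)) := by rw [hσ]; ring
  rw [e, pow_mul]
  calc (theta1 r ^ (r + 3)) ^ (32 * (r + 1) * (r + 3)) ≤ (1 / 2 : ℝ) ^ (32 * (r + 1) * (r + 3)) :=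
        pow_le_pow_left₀ (pow_nonneg (theta1_pos r).le _) (theta1_pow_le_half r) _
    _ ≤ (1 / 2 : ℝ) ^ 1 := pow_le_pow_of_le_one (by norm_num) (by norm_num) (by nlinarith)
    _ = 1 / 2 := pow_one _

/-- **Unimodality of `q ↦ u_q`** for large `n`: there is a mode `qs > q₀` with `u` non-decreasing
before and non-increasing after it. [folklore] -/
theorem exists_mode (hD : 0 < D) (hS : s + 1 = D * σ) (hr : 1 ≤ r)
    (hσ : σ = 32 * (r + 1) * (r + 3) ^ 2) (hn : 1 ≤ n) (hrn : 2 ≤ r * n)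
    (hσn : (σ : ℝ) < D * ((r : ℝ) * n - 1)) {q₀ : ℕ} (hq0Q : (q₀ : ℝ) + 1 ≤ Qone r D σ n)
    (hq0 : 2 * (q₀ : ℝ) ≤ (2 * r + 1) * D * n * (((r : ℝ) - 1) / ((r : ℝ) + 1)) ^ σ) :
    ∃ qs : ℕ, q₀ < qs ∧ (∀ q, q < qs → useq r D s n q ≤ useq r D s n (q + 1)) ∧
      (∀ q, qs ≤ q → useq r D s n (q + 1) ≤ useq r D s n q) := by
  set u := useq r D s n with hu
  have hQ0 : (0 : ℝ) ≤ Qone r D σ n := by linarith [(Nat.cast_nonneg (α := ℝ) q₀)]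
  have hQ1 : 1 ≤ Qone r D σ n := by linarith [(Nat.cast_nonneg (α := ℝ) q₀)]
  have hθ := theta1_pow_sigma_le (r := r) hσ
  have hσr : (r + 1) * (r + 5) ≤ σ := by rw [hσ]; nlinarith
  have hQ21 := Qtwo_le_Qone hD hr hσ hrn
  -- the finite range and its argmax
  set Qm : ℕ := ⌊Qone r D σ n⌋₊ + 1 with hQm
  have hQm1 : (Qm : ℝ) ≤ Qone r D σ n + 1 := by
    rw [hQm]; push_cast; linarith [Nat.floor_le hQ0]
  have hQm2 : Qone r D σ n < Qm := by rw [hQm]; push_cast; exact Nat.lt_floor_add_one _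
  have hq0m : q₀ + 2 ≤ Qm := by
    have : q₀ + 1 ≤ ⌊Qone r D σ n⌋₊ := Nat.le_floor (by push_cast; exact hq0Q)
    omega
  obtain ⟨qs, hqsmem, hmax⟩ := exists_max_image (range (Qm + 1)) u ⟨0, by simp⟩
  have hqsQm : qs ≤ Qm := Nat.lt_succ_iff.1 (mem_range.1 hqsmem)
  have hmax' : ∀ q, q ≤ Qm → u q ≤ u qs := fun q hq => hmax q (mem_range.2 (Nat.lt_succ_of_le hq))
  -- strict increase on `[0, q₀ + 1]`
  have hupos : ∀ q, 1 ≤ q → 0 < u q := fun q hq => useq_pos hD hq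
  have hstrict : ∀ q, q ≤ q₀ → u q < u (q + 1) := by
    intro q hq
    rcases Nat.eq_zero_or_pos q with h0 | hpos
    · subst h0; rw [hu, useq_zero]; exact useq_pos hD le_rfl
    · have h2 := two_le_rho (σ := σ) hD hS hr hn hpos hq hq0
      rw [hu, useq_succ hD hpos]
      have := hupos q hpos
      nlinarith
  have hchain : ∀ q, q ≤ q₀ + 1 → ∀ q', q' ≤ q → u q' ≤ u q := by
    intro q hq q' hq'
    obtain ⟨d, rfl⟩ := Nat.exists_eq_add_of_le hq'
    induction d with
    | zero => exact le_rfl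
    | succ d ih =>
      have h1 := ih (by omega) (by omega)
      have h2 := hstrict (q' + d) (by omega)
      rw [← add_assoc]; linarith
  -- (a) the mode is beyond `q₀`
  have hqs0 : q₀ < qs := by
    by_contra h
    rw [not_lt] at h
    have h1 : u qs < u (q₀ + 1) := lt_of_le_of_lt (hchain q₀ (by omega) qs h) (hstrict q₀ le_rfl)
    have h2 : u (q₀ + 1) ≤ u qs := hmax' (q₀ + 1) (by omega)
    linarith
  have hqs1 : 1 ≤ qs := by omega
  -- `ρ_{qs} ≤ 1`
  have hρqs : rho r D s n qs ≤ 1 := by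
    rcases lt_or_ge qs Qm with hlt | hge
    · have h1 : u (qs + 1) ≤ u qs := hmax' (qs + 1) hlt
      rw [hu, useq_succ hD hqs1] at h1
      have := hupos qs hqs1
      by_contra h; rw [not_le] at h
      nlinarith
    · have hqsQ : Qtwo r D σ n ≤ qs := by
        have : (Qm : ℝ) ≤ qs := by exact_mod_cast hge
        linarith
      exact rho_le_one_of_Qtwo_le hD hS hn hθ hσr hqs1 hqsQ
  refine ⟨qs, hqs0, fun q hq => ?_, fun q hq => ?_⟩
  · -- (b) non-decreasing before the mode
    rcases Nat.eq_zero_or_pos q with h0 | hpos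
    · subst h0; rw [hu, useq_zero]; exact (useq_pos hD le_rfl).le
    · -- `ρ_q ≥ ρ_{qs-1} ≥ 1`
      have hqs2 : 2 ≤ qs := by omega
      have h1 : u (qs - 1) ≤ u qs := hmax' (qs - 1) (by omega)
      have h2 : u qs = rho r D s n (qs - 1) * u (qs - 1) := by
        have := useq_succ (r := r) (D := D) (s := s) (n := n) hD (q := qs - 1) (by omega)
        rw [show qs - 1 + 1 = qs by omega] at this; rw [hu]; exact this
      have h3 : 1 ≤ rho r D s n (qs - 1) := by
        have := hupos (qs - 1) (by omega)
        by_contra h; rw [not_le] at h; nlinarith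
      have h4 : rho r D s n (qs - 1) ≤ rho r D s n q :=
        rho_antitone hD hS hrn hσn hQ1 hpos (by omega) (by
          have : ((qs - 1 : ℕ) : ℝ) = (qs : ℝ) - 1 := by push_cast [Nat.cast_sub hqs1]; ring
          rw [this]; have : (qs : ℝ) ≤ Qm := by exact_mod_cast hqsQm
          linarith)
      rw [hu, useq_succ hD hpos]
      have := hupos q hpos
      nlinarith
  · -- (c) non-increasing after the mode
    have hq1 : 1 ≤ q := le_trans hqs1 hq
    have hρ : rho r D s n q ≤ 1 := by
      rcases le_or_gt (Qtwo r D σ n) q with hQ2 | hQ2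
      · exact rho_le_one_of_Qtwo_le hD hS hn hθ hσr hq1 hQ2
      · have h1 : rho r D s n q ≤ rho r D s n qs :=
          rho_antitone hD hS hrn hσn hQ1 hqs1 hq (by linarith)
        exact h1.trans hρqs
    rw [hu, useq_succ hD hq1]
    have := hupos q hq1
    nlinarith

/-! ### Comparison of the class sums -/

/-- `classSum ≥ 0` and the summability of `u`. [folklore] -/
theorem summable_useq (hD : 0 < D) (hr : 1 ≤ r) (hn : 1 ≤ n) (hs : (2 * r + 1) * D + 2 ≤ s + 1) :
    Summable (useq r D s n) := (tsum_useq_le hD hr hn hs).1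

/-- Summability along a residue class. [folklore] -/
theorem summable_useq_class (hD : 0 < D) (hr : 1 ≤ r) (hn : 1 ≤ n)
    (hs : (2 * r + 1) * D + 2 ≤ s + 1) (j : ℕ) :
    Summable (fun k : ℕ => useq r D s n (k * D + j)) :=
  (summable_useq hD hr hn hs).comp_injective fun x y h => by
    have h' : x * D + j = y * D + j := h
    exact Nat.eq_of_mul_eq_mul_right hD (by omega)

/-- `0 < r_{n,j}` for `1 ≤ j`. [folklore] -/
theorem classSum_pos (hD : 0 < D) (hr : 1 ≤ r) (hn : 1 ≤ n) (hs : (2 * r + 1) * D + 2 ≤ s + 1)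
    {j : ℕ} (hj : 1 ≤ j) : 0 < classSum r D s n j := by
  unfold classSum
  have hsc := summable_useq_class hD hr hn hs j
  have h1 : useq r D s n (0 * D + j) ≤ ∑' k : ℕ, useq r D s n (k * D + j) :=
    hsc.le_tsum 0 fun k _ => (useq_pos hD (by omega)).le
  exact lt_of_lt_of_le (useq_pos hD (by omega)) (by simpa using h1)

/-- `r_{n,j} ≤ ∑_q u_q ≤ 3Dr γ^n`. [folklore] -/
theorem classSum_le_gam (hD : 0 < D) (hr : 1 ≤ r) (hn : 1 ≤ n) (hs : (2 * r + 1) * D + 2 ≤ s + 1)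
    (j : ℕ) : classSum r D s n j ≤ ((3 * D * r : ℕ) : ℝ) * gam r D s ^ n := by
  obtain ⟨hsum, hle⟩ := tsum_useq_le (s := s) hD hr hn hs
  refine le_trans ?_ hle
  unfold classSum
  have hnn : ∀ q, 0 ≤ useq r D s n q := fun q => by
    rcases Nat.eq_zero_or_pos q with h0 | hp
    · rw [h0, useq_zero]
    · exact (useq_pos hD hp).le
  exact tsum_comp_le_tsum_of_inj hsum hnn (i := fun k => k * D + j) fun x y h => by
    have h' : x * D + j = y * D + j := h
    exact Nat.eq_of_mul_eq_mul_right hD (by omega)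

/-- `R_n` vanishes at `rn - l/D`, `0 ≤ l ≤ L`. [folklore] -/
theorem Rfun_root (l : ℕ) (hl : l ≤ Lnum r D n) : Rfun r D s n ((r : ℝ) * n - (l : ℝ) / D) = 0 := by
  unfold Rfun
  rw [prod_eq_zero (i := l) (mem_range.2 (Nat.lt_succ_of_le hl)) (by ring)]
  simp

/-- **The twisted sum is a class sum**: `∑_{m ≥ 0} R_n(m + 1 + j/D) = ∑_k u_{kD+j}` for
`1 ≤ j ≤ D` (the terms with `m + 1 ≤ rn - 1` vanish). [cite: FischlerSprangZudilin2019, §4 (r_{n,j} = ∑_{k ≥ 0} c_{k,j})] -/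
theorem hasSum_Rfun_classSum (hD : 0 < D) (hr : 1 ≤ r) (hn : 1 ≤ n)
    (hs : (2 * r + 1) * D + 2 ≤ s + 1) {j : ℕ} (hj1 : 1 ≤ j) (hjD : j ≤ D) :
    HasSum (fun m : ℕ => Rfun r D s n ((m : ℝ) + 1 + (j : ℝ) / D)) (classSum r D s n j) := by
  have hD' : (0 : ℝ) < D := by exact_mod_cast hD
  have hα : (0 : ℝ) ≤ (j : ℝ) / D := by positivity
  have hsum := summable_Rfun (r := r) (D := D) (s := s) (n := n) hn hD hs hα
  have hrn : 1 ≤ r * n := Nat.one_le_iff_ne_zero.2 (by positivity)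
  set K := r * n - 1 with hK
  have hsplit := (Summable.sum_add_tsum_nat_add K hsum).symm
  -- the first `K` terms vanish
  have hzero : ∀ m ∈ range K, Rfun r D s n ((m : ℝ) + 1 + (j : ℝ) / D) = 0 := by
    intro m hm
    have hm' : m < K := mem_range.1 hm
    have hl1 : j ≤ D * (r * n - 1 - m) := le_trans hjD (Nat.le_mul_of_pos_right D (by omega))
    set l := D * (r * n - 1 - m) - j with hl
    have hlL : l ≤ Lnum r D n := by
      rw [hl, Lnum]
      have : D * (r * n - 1 - m) ≤ (2 * r + 1) * D * n := by nlinarith [Nat.sub_le (r * n - 1) m, Nat.sub_le (r * n) 1]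
      omega
    have e : (m : ℝ) + 1 + (j : ℝ) / D = (r : ℝ) * n - (l : ℝ) / D := by
      rw [hl, Nat.cast_sub hl1, Nat.cast_mul, Nat.cast_sub (by omega : m ≤ r * n - 1),
        Nat.cast_sub hrn]
      push_cast
      field_simp
      ring
    rw [e]; exact Rfun_root l hlL
  -- the remaining terms are the `u_{kD+j}`
  have hshift : ∀ m : ℕ, Rfun r D s n (((m + K : ℕ) : ℝ) + 1 + (j : ℝ) / D) = useq r D s n (m * D + j) := by
    intro m
    unfold useq
    congr 1
    rw [hK]; push_cast [Nat.cast_sub hrn]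
    field_simp
    ring
  have hval : ∑' m : ℕ, Rfun r D s n ((m : ℝ) + 1 + (j : ℝ) / D) = classSum r D s n j := by
    rw [hsplit, sum_eq_zero hzero, zero_add]
    unfold classSum
    exact tsum_congr hshift
  rw [← hval]
  exact hsum.hasSum

/-- The real-arithmetic core of the comparison: from the flat-peak bound, the pairwise bound and
the block decomposition one gets `C ≤ (1+η) C'`. [folklore] -/
theorem ratio_bound {D t M U C C' η : ℝ} (hD : 1 ≤ D) (hη : 0 < η) (hC' : 0 ≤ C')
    (ht : 2 * D ^ 2 * (1 + η) / η ≤ t) (hflat : (t + 1) * M ≤ 2 * U)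
    (hU : U ≤ D * (C' + D * M)) (hpair : C ≤ C' + D * M) : C ≤ (1 + η) * C' := by
  have htge' : 2 * D ^ 2 * (1 + η) ≤ η * t := by
    rw [div_le_iff₀ hη] at ht; linarith
  have hc : 2 * D ^ 2 < t + 1 := by
    have h1 : 2 * D ^ 2 ≤ 2 * D ^ 2 * (1 + η) / η := by
      rw [le_div_iff₀ hη]; nlinarith [sq_nonneg D]
    linarith
  have hcpos : 0 < t + 1 - 2 * D ^ 2 := by linarith
  have h1 : D * M * (t + 1 - 2 * D ^ 2) ≤ 2 * D ^ 2 * C' := by nlinarith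
  have h2 : 2 * D ^ 2 * C' ≤ η * C' * (t + 1 - 2 * D ^ 2) := by
    have : 2 * D ^ 2 ≤ η * (t + 1 - 2 * D ^ 2) := by nlinarith
    nlinarith
  have hDM : D * M ≤ η * C' := le_of_mul_le_mul_right (h1.trans h2) hcpos
  linarith

/-- Largeness of `n`: the four consequences used below. [folklore] -/
theorem large_n (hD : 0 < D) (hr : 1 ≤ r) (hσpos : 0 < σ) {q₀ : ℕ} {π₀ : ℝ} (hπ₀pos : 0 < π₀)
    (hn2 : 2 ≤ n) (hnσ : σ + 2 ≤ n) (hnq : 4 * σ * (q₀ + 2) + 1 ≤ n)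
    (hnπ : ⌈2 * (q₀ : ℝ) / π₀⌉₊ + 1 ≤ n) :
    2 ≤ r * n ∧ (σ : ℝ) < D * ((r : ℝ) * n - 1) ∧ (q₀ : ℝ) + 1 ≤ Qone r D σ n ∧
      2 * (q₀ : ℝ) ≤ (2 * r + 1) * D * n * π₀ := by
  have hD' : (1 : ℝ) ≤ D := by exact_mod_cast hD
  have hr' : (1 : ℝ) ≤ r := by exact_mod_cast hr
  have hn' : (2 : ℝ) ≤ n := by exact_mod_cast hn2
  have hrn : 2 ≤ r * n := by nlinarith
  have hrnR : (n : ℝ) - 1 ≤ (r : ℝ) * n - 1 := by nlinarith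
  have hDrn : (n : ℝ) - 1 ≤ (D : ℝ) * ((r : ℝ) * n - 1) := by
    nlinarith [mul_le_mul hD' hrnR (by linarith) (by linarith)]
  have hnσ' : ((σ + 2 : ℕ) : ℝ) ≤ n := by exact_mod_cast hnσ
  push_cast at hnσ'
  refine ⟨hrn, by linarith, ?_, ?_⟩
  · unfold Qone
    have hσR : (0 : ℝ) < σ := by exact_mod_cast hσpos
    rw [le_div_iff₀ (by positivity)]
    have h1 : ((4 * σ * (q₀ + 2) + 1 : ℕ) : ℝ) ≤ n := by exact_mod_cast hnq
    push_cast at h1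
    nlinarith
  · have h1 : ((⌈2 * (q₀ : ℝ) / π₀⌉₊ + 1 : ℕ) : ℝ) ≤ n := by exact_mod_cast hnπ
    push_cast at h1
    have h2 : 2 * (q₀ : ℝ) / π₀ ≤ ⌈2 * (q₀ : ℝ) / π₀⌉₊ := Nat.le_ceil _
    have h3 : 2 * (q₀ : ℝ) ≤ n * π₀ := by
      rw [div_le_iff₀ hπ₀pos] at h2; nlinarith
    have h4 : (n : ℝ) * π₀ ≤ (2 * r + 1) * D * n * π₀ := by
      have : (1 : ℝ) ≤ (2 * r + 1) * D := by nlinarith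
      nlinarith [mul_le_mul_of_nonneg_right this (by positivity : (0:ℝ) ≤ (n:ℝ) * π₀)]
    linarith

/-- **The twisted sums are comparable** (the non-vanishing input replacing FSZ 2019, Lemma 3,
`r_{n,j}/r_{n,j'} → 1`): for every `η > 0` there is `N₀` such that for all `n ≥ N₀` and all
`1 ≤ j, j' ≤ D`, `r_{n,j} ≤ (1 + η) r_{n,j'}` (parameters `D ≥ 1`, `r ≥ 2`,
`σ = 32(r+1)(r+3)²`, `s + 1 = Dσ`). [cite: FischlerSprangZudilin2019, Lemma 3 (second assertion)] -/
theorem classSum_le (hD : 0 < D) (hS : s + 1 = D * σ) (hr : 2 ≤ r)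
    (hσ : σ = 32 * (r + 1) * (r + 3) ^ 2) {η : ℝ} (hη : 0 < η) :
    ∃ N₀ : ℕ, ∀ n : ℕ, N₀ ≤ n → ∀ j j' : ℕ, 1 ≤ j → j ≤ D → 1 ≤ j' → j' ≤ D →
      classSum r D s n j ≤ (1 + η) * classSum r D s n j' := by
  have hr1 : 1 ≤ r := by omega
  have hD' : (1 : ℝ) ≤ D := by exact_mod_cast hD
  have hr' : (2 : ℝ) ≤ r := by exact_mod_cast hr
  have hσpos : 0 < σ := by rw [hσ]; positivity
  have hσ3 : 2 * r + 3 ≤ σ := by rw [hσ]; nlinarith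
  have hs2 : (2 * r + 1) * D + 2 ≤ s + 1 := by
    rw [hS]
    have : (2 * r + 3) * D ≤ σ * D := Nat.mul_le_mul_right D hσ3
    nlinarith
  -- the constants
  set t : ℕ := ⌈2 * (D : ℝ) ^ 2 * (1 + η) / η⌉₊ with ht
  set q₀ : ℕ := 2 * t ^ 2 + t with hq₀
  set π₀ : ℝ := (((r : ℝ) - 1) / ((r : ℝ) + 1)) ^ σ with hπ₀
  have hπ₀pos : 0 < π₀ := by rw [hπ₀]; apply pow_pos; apply div_pos <;> linarith
  set N₁ : ℕ := 4 * σ * (q₀ + 2) + 1 with hN₁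
  set N₂ : ℕ := ⌈2 * (q₀ : ℝ) / π₀⌉₊ + 1 with hN₂
  refine ⟨2 + (σ + 2) + N₁ + N₂, fun n hn j j' hj1 hjD hj1' hjD' => ?_⟩
  have hn1 : 1 ≤ n := by omega
  obtain ⟨hrn, hσn, hq0Q, hq0⟩ := large_n (r := r) (D := D) (σ := σ) (n := n) (q₀ := q₀) hD hr1 hσpos
    hπ₀pos (by omega) (by omega) (by omega) (by omega)
  -- the mode
  obtain ⟨qs, hqs0, hinc, hdec⟩ := exists_mode (s := s) hD hS hr1 hσ hn1 hrn hσn hq0Q hq0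
  set u := useq r D s n with hu
  have hsumu : Summable u := summable_useq hD hr1 hn1 hs2
  have hu0 : ∀ q, 0 ≤ u q := fun q => by
    rcases Nat.eq_zero_or_pos q with h0 | hp
    · rw [h0, hu, useq_zero]
    · exact (useq_pos hD hp).le
  -- flat peak and block decomposition
  have hflat : ((t : ℝ) + 1) * u qs ≤ 2 * ∑ q ∈ Icc (qs - t) qs, u q :=
    flat_peak (u := u) (ρ := rho r D s n) (fun q hq => useq_pos hD hq)
      (fun q hq => useq_succ hD hq) (fun q hq => rho_drift hq) (hdec qs le_rfl)
      (by rw [hq₀] at hqs0; omega)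
  have hIcc : ∑ q ∈ Icc (qs - t) qs, u q ≤ ∑' q, u q := hsumu.sum_le_tsum _ fun q _ => hu0 q
  have hblock := tsum_eq_sum_tsum_block hsumu (D := D) hD
  -- the pairwise bound
  have hpair : ∀ a b : ℕ, 1 ≤ a → a ≤ D → 1 ≤ b → b ≤ D →
      classSum r D s n a ≤ classSum r D s n b + D * u qs := by
    intro a b ha1 haD hb1 hbD
    have hMnn : 0 ≤ u qs := hu0 qs
    rcases le_total a b with hab | hab
    · have h := abs_tsum_sub_le_of_unimodal' hu0 hsumu hinc hdec hD a (b - a)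
      rw [show a + (b - a) = b by omega] at h
      have h2 : ((b - a : ℕ) : ℝ) * u qs ≤ D * u qs := by
        refine mul_le_mul_of_nonneg_right ?_ hMnn
        exact_mod_cast (show b - a ≤ D by omega)
      have := (abs_sub_le_iff.1 h).2
      unfold classSum; rw [← hu]; linarith
    · have h := abs_tsum_sub_le_of_unimodal' hu0 hsumu hinc hdec hD b (a - b)
      rw [show b + (a - b) = a by omega] at h
      have h2 : ((a - b : ℕ) : ℝ) * u qs ≤ D * u qs := by
        refine mul_le_mul_of_nonneg_right ?_ hMnn
        exact_mod_cast (show a - b ≤ D by omega)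
      have := (abs_sub_le_iff.1 h).1
      unfold classSum; rw [← hu]; linarith
  have hclass0 : ∑' k, u (k * D + 0) = classSum r D s n D := by
    have hs0 : Summable (fun k => u (k * D + 0)) := by
      rw [hu]; exact summable_useq_class hD hr1 hn1 hs2 0
    rw [hs0.tsum_eq_zero_add, show u (0 * D + 0) = 0 by rw [hu]; simp [useq_zero], zero_add]
    unfold classSum; rw [← hu]
    exact tsum_congr fun k => by congr 1; ring
  have hT : ∀ i ∈ range D, ∑' k, u (k * D + i) ≤ classSum r D s n j' + D * u qs := by
    intro i hi
    have hiD : i < D := mem_range.1 hi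
    rcases Nat.eq_zero_or_pos i with h0 | hp
    · rw [h0, hclass0]; exact hpair D j' hD le_rfl hj1' hjD'
    · exact hpair i j' hp hiD.le hj1' hjD'
  have hUle : ∑' q, u q ≤ D * (classSum r D s n j' + D * u qs) := by
    rw [hblock]
    calc ∑ i ∈ range D, ∑' k, u (k * D + i) ≤ ∑ _i ∈ range D, (classSum r D s n j' + D * u qs) :=
          sum_le_sum hT
      _ = D * (classSum r D s n j' + D * u qs) := by rw [sum_const, card_range, nsmul_eq_mul]
  -- conclude
  exact ratio_bound (t := (t : ℝ)) (M := u qs) (U := ∑' q, u q) hD' hη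
    (classSum_pos (s := s) hD hr1 hn1 hs2 hj1').le (Nat.le_ceil _) (by linarith [hflat, hIcc])
    hUle (hpair j j' hj1 hjD hj1' hjD')

end Assembly

end Literature.NumberTheory.Transcendental.OddZeta
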